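import Literature.Analysis.FluidPDE.OnsagerBDSVGluedTriple
import Literature.Analysis.FluidPDE.OnsagerBDSVGluedParams
import Literature.Analysis.FunctionSpaces.ContDiffHolderAlgebra
import HarnessLib

/-!
# The BDSV gluing stage: Prop. 4.2 — the bounds (2.18), (2.19) on the glued velocity

Buckmaster–De Lellis–Székelyhidi–Vicol, *Onsager's conjecture for admissible weak solutions*,
CPAM 72 (2019) = arXiv:1701.08678, §4.3, Prop. 4.2: "The velocity field `v̄_q` satisfies
`‖v̄_q - v_q‖_α ≲ δ_{q+1}^{1/2} ℓ^α` (4.4) and `‖v̄_q‖_{1+N} ≲ δ_q^{1/2} λ_q ℓ^{-N}` (4.5) for all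
`N ≥ 0`", proved from (3.12) "using `χᵢ² + (1 - χᵢ)² ≥ 1/2` … and the inequality
`δ_{q+1}^{1/2} τ_q ℓ^{-1} ≤ λ_q^{-α/2} ≤ 1`" (4.6), then "By (3.11) and (2.6) …
`‖v̄_q‖_{1+N} ≤ ‖v_ℓ‖_{1+N} + ‖v_ℓ - v̄_q‖_{1+N} ≲ δ_q^{1/2}λ_qℓ^{-N} + τ_qδ_{q+1}ℓ^{-1-N+α} ≲ δ_q^{1/2}λ_qℓ^{-N}`".

For the glued velocity `BDSV.gluedVel` of a `BDSV.IsGlueFamily` whose members obey the §3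
stability bounds `BDSV.StabilityBounds` (constant `C₃`, orders `≤ N̄`), this file proves, with
explicit constants:

* `BDSV.IsGlueFamily.exists_convex_decomp` — at every `t ∈ [0,T]`, `v̄(t) = θvᵢ(t) + (1-θ)vᵢ'(t)`
  with `θ ∈ [0,1]` and `t` in the life spans of `vᵢ`, `vᵢ'` (`i' = i+1`, or `i' = i = n`);
* `BDSV.IsGlueFamily.holderSupLE_gluedVel_sub` — `‖v̄ - v_ℓ‖_{N+α} ≤ |C₃| τ_q δ_{q+1} ℓ^{-N-1+α}`
  on `[0,T]` for `N ≤ N̄` ((3.12) transported to `v̄`; the source of (4.4) and of the bounds of §4.4);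
* `BDSV.IsGlueFamily.supLE_gluedVel_sub` — **(2.18)** = (4.4): `|v̄ - v_ℓ| ≤ |C₃| δ_{q+1}^{1/2} ℓ^α`;
* `BDSV.IsGlueFamily.holderSupLE_gluedVel` — **(2.19)** = (4.5):
  `‖v̄‖_{N+1} ≤ (|Cin N| + 3|C₃|) δ_q^{1/2} λ_q ℓ^{-N}` for `N + 1 ≤ N̄`, given (2.13) for `v_ℓ`;
* `BDSV.eContDiffHolderNorm_succ_le_of_holderSupLE` — the interpolated form of (2.13) used in
  §4.4: `‖v_ℓ‖_{N+1+α} ≤ ((N+4)|Cin N| + |Cin (N+1)|) δ_q^{1/2} λ_q ℓ^{-N-α}`.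

## References

* T. Buckmaster, C. De Lellis, L. Székelyhidi Jr., V. Vicol, *Onsager's conjecture for admissible
  weak solutions*, Comm. Pure Appl. Math. 72 (2019) 229–274 = arXiv:1701.08678, §4.3 (Prop. 4.2,
  (4.4)–(4.6)), §2.4 (2.13), §2.5 (2.18)–(2.19).
-/

noncomputable section

open MeasureTheory Set Filter Topology Function
open scoped NNReal ENNReal ContDiff

namespace Literature.Analysis.FluidPDE

namespace BDSV

open FunctionSpaces FunctionSpaces.Torus

/-- The flat three-torus `T³ = (ℝ/ℤ)³`, local notation. -/
local notation "𝕋³" => UnitAddTorus (Fin 3)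

/-- Euclidean `ℝ³`, local notation. -/
local notation "ℝ³" => EuclideanSpace ℝ (Fin 3)

/-! ## One more parameter inequality -/

section Params

variable {β α a b : ℝ}

/-- `τ_q δ_{q+1} ℓ^{-1+α} ≤ δ_{q+1}^{1/2} ℓ^α` (from (4.6) `δ_{q+1}^{1/2}τ_q ≤ ℓ`): the conversion
of (3.12) at `N = 0` into (4.4) = (2.18). [cite: BuckmasterEtAl2018, Prop. 4.2 (proof)] -/
theorem glueScale_mul_amp_succ_mul_rpow_le_sqrt (ha : 1 ≤ a) (hb : 1 ≤ b) (hβ : 0 ≤ β) (hα : 0 ≤ α)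
    (q : ℕ) :
    glueScale β α a b q * amp β a b (q + 1) * mollScale β α a b q ^ (-1 + α) ≤
      Real.sqrt (amp β a b (q + 1)) * mollScale β α a b q ^ α := by
  have hℓ := mollScale_pos (β := β) (α := α) (b := b) ha q
  have hδ1 := amp_pos (β := β) (b := b) ha (q + 1)
  have h46 := sqrt_amp_succ_mul_glueScale_le ha hb hβ hα q
  have e : glueScale β α a b q * amp β a b (q + 1) * mollScale β α a b q ^ (-1 + α) =
      (Real.sqrt (amp β a b (q + 1)) * glueScale β α a b q) *
        (Real.sqrt (amp β a b (q + 1)) * mollScale β α a b q ^ (-1 + α)) := by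
    calc glueScale β α a b q * amp β a b (q + 1) * mollScale β α a b q ^ (-1 + α)
        = glueScale β α a b q * (Real.sqrt (amp β a b (q + 1)) * Real.sqrt (amp β a b (q + 1))) *
            mollScale β α a b q ^ (-1 + α) := by rw [Real.mul_self_sqrt hδ1.le]
      _ = _ := by ring
  rw [e]
  calc (Real.sqrt (amp β a b (q + 1)) * glueScale β α a b q) *
        (Real.sqrt (amp β a b (q + 1)) * mollScale β α a b q ^ (-1 + α))
      ≤ mollScale β α a b q * (Real.sqrt (amp β a b (q + 1)) * mollScale β α a b q ^ (-1 + α)) :=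
        mul_le_mul_of_nonneg_right h46 (by positivity)
    _ = Real.sqrt (amp β a b (q + 1)) * (mollScale β α a b q ^ (1 : ℝ) * mollScale β α a b q ^ (-1 + α)) := by
        rw [Real.rpow_one]; ring
    _ = Real.sqrt (amp β a b (q + 1)) * mollScale β α a b q ^ α := by
        rw [← Real.rpow_add hℓ]; norm_num

end Params

/-! ## Convex combinations in `C^{k,r}` -/

section Convex

variable {f g : 𝕋³ → ℝ³} {k : ℕ} {r : ℝ≥0} {θ B : ℝ}

/-- A convex combination of two fields each of `C^{k,r}` norm `≤ B` has norm `≤ B`. [folklore] -/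
theorem eContDiffHolderNorm_convex_comb_le (hf : IsContDiff k f) (hg : IsContDiff k g)
    (hθ : θ ∈ Icc (0 : ℝ) 1) (hfB : Torus.eContDiffHolderNorm k r f ≤ ENNReal.ofReal B)
    (hgB : Torus.eContDiffHolderNorm k r g ≤ ENNReal.ofReal B) :
    Torus.eContDiffHolderNorm k r (fun x => θ • f x + (1 - θ) • g x) ≤ ENNReal.ofReal B := by
  have e : (fun x => θ • f x + (1 - θ) • g x) = θ • f + (1 - θ) • g := rfl
  have h1 : 0 ≤ 1 - θ := sub_nonneg.2 hθ.2
  rw [e]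
  calc Torus.eContDiffHolderNorm k r (θ • f + (1 - θ) • g)
      ≤ Torus.eContDiffHolderNorm k r (θ • f) + Torus.eContDiffHolderNorm k r ((1 - θ) • g) :=
        Torus.eContDiffHolderNorm_add_le (hf.smul θ) (hg.smul (1 - θ))
    _ = ‖θ‖ₑ * Torus.eContDiffHolderNorm k r f + ‖1 - θ‖ₑ * Torus.eContDiffHolderNorm k r g := by
        rw [Torus.eContDiffHolderNorm_const_smul hf θ, Torus.eContDiffHolderNorm_const_smul hg (1 - θ)]
    _ ≤ ENNReal.ofReal θ * ENNReal.ofReal B + ENNReal.ofReal (1 - θ) * ENNReal.ofReal B := by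
        rw [Real.enorm_eq_ofReal hθ.1, Real.enorm_eq_ofReal h1]
        gcongr
    _ = ENNReal.ofReal B := by
        rw [← add_mul, ← ENNReal.ofReal_add hθ.1 h1, add_sub_cancel, ENNReal.ofReal_one, one_mul]

end Convex

/-! ## The interpolated form of (2.13) -/

section Interp

variable {β α a b T : ℝ} {q : ℕ} {vℓ : ℝ → 𝕋³ → ℝ³} {Cin : ℕ → ℝ}

/-- **(2.13) interpolated**: from `‖v_ℓ‖_{N+1} ≤ C_N δ_q^{1/2}λ_qℓ^{-N}` for all `N` (sup norms
of derivatives) one gets `‖v_ℓ(t)‖_{N+1+α} ≤ ((N+4)|C_N| + |C_{N+1}|) δ_q^{1/2} λ_q ℓ^{-N-α}` on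
`[0,T]`, by `[D^{N+1}v]_α ≤ ‖D^{N+2}v‖_∞ ℓ^{1-α} + 2‖D^{N+1}v‖_∞ ℓ^{-α}` (interpolation at scale
`ℓ ≤ 1`; BDSV use `‖v_ℓ‖_{N+α} ≲ δ_q^{1/2}λ_qℓ^{1-N-α}` throughout §§3–4, e.g. in the proof of
Prop. 4.3). [cite: BuckmasterEtAl2018, §2.4 (2.13) and §4.4 (proof of Prop. 4.3)] -/
theorem eContDiffHolderNorm_succ_le_of_holderSupLE (hα : 0 < α) (hα1 : α < 1)
    (hℓ : 0 < mollScale β α a b q) (hℓ1 : mollScale β α a b q ≤ 1)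
    (hA' : 0 ≤ Real.sqrt (amp β a b q) * freq a b q)
    (hsm : ∀ t ∈ Icc 0 T, FunctionSpaces.Torus.IsSmooth (vℓ t))
    (h213 : ∀ N : ℕ, HolderSupLE T vℓ (N + 1) 0
      (Cin N * (Real.sqrt (amp β a b q) * freq a b q * mollScale β α a b q ^ (-(N : ℝ)))))
    {t : ℝ} (ht : t ∈ Icc 0 T) (N : ℕ) :
    FunctionSpaces.Torus.eContDiffHolderNorm (N + 1) (Real.toNNReal α) (vℓ t) ≤
      ENNReal.ofReal ((((N : ℝ) + 4) * |Cin N| + |Cin (N + 1)|) *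
        (Real.sqrt (amp β a b q) * freq a b q * mollScale β α a b q ^ (-(N : ℝ) - α))) := by
  set ℓ := mollScale β α a b q with hℓdef
  set A := Real.sqrt (amp β a b q) * freq a b q with hA
  -- the two instances of (2.13)
  have h0 := h213 N t ht
  have h1 := h213 (N + 1) t ht
  set B₀ := Cin N * (A * ℓ ^ (-(N : ℝ))) with hB₀
  set B₁ := Cin (N + 1) * (A * ℓ ^ (-((N + 1 : ℕ) : ℝ))) with hB₁
  -- pointwise derivative bounds
  set M : ℕ → ℝ := fun i => if i ≤ N + 1 then max B₀ 0 else max B₁ 0 with hM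
  have hM0 : ∀ i, 0 ≤ M i := fun i => by
    simp only [hM]; split_ifs <;> exact le_max_right _ _
  have hg : ContDiff ℝ (N + 1 + 1) (FunctionSpaces.Torus.lift (vℓ t)) :=
    (hsm t ht).isContDiff (n := N + 1 + 1) (mod_cast le_top)
  have hMb : ∀ i ≤ N + 1 + 1, ∀ y : EuclideanSpace ℝ (Fin 3),
      ‖iteratedFDeriv ℝ i (FunctionSpaces.Torus.lift (vℓ t)) y‖ ≤ M i := by
    intro i hi y
    rcases Nat.lt_or_ge i (N + 2) with hi2 | hi2
    · have hi1 : i ≤ N + 1 := by omega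
      simp only [hM, if_pos hi1]
      exact norm_iteratedFDeriv_lift_le_of_eContDiffHolderNorm_le h0 hi1 y
    · have hi2' : i = N + 1 + 1 := by omega
      subst hi2'
      simp only [hM, show ¬ (N + 1 + 1 ≤ N + 1) from by omega, if_false]
      exact norm_iteratedFDeriv_lift_le_of_eContDiffHolderNorm_le h1 le_rfl y
  have hr : Real.toNNReal α ≤ 1 := by
    rw [← NNReal.coe_le_coe, Real.coe_toNNReal α hα.le, NNReal.coe_one]; exact hα1.le
  have key := FunctionSpaces.eContDiffHolderNorm_le_of_norm_iteratedFDeriv_le (k := N + 1) hg hM0 hMb hr hℓ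
  refine le_trans key (ENNReal.ofReal_le_ofReal ?_)
  have hαc : ((Real.toNNReal α : ℝ≥0) : ℝ) = α := Real.coe_toNNReal α hα.le
  have hsum : (∑ i ∈ Finset.range (N + 1 + 1), M i) = ((N : ℝ) + 2) * max B₀ 0 := by
    rw [Finset.sum_congr rfl fun i hi => by
      rw [show M i = max B₀ 0 from if_pos (Nat.lt_succ_iff.1 (Finset.mem_range.1 hi))]]
    rw [Finset.sum_const, Finset.card_range, nsmul_eq_mul]
    push_cast
    ring
  have hM1 : M (N + 1) = max B₀ 0 := by simp [hM]
  have hM2 : M (N + 1 + 1) = max B₁ 0 := by simp [hM]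
  rw [hαc, hsum, hM1, hM2]
  -- bounds on the maxima
  have hA0 : 0 ≤ A := hA'
  have hℓN : 0 ≤ ℓ ^ (-(N : ℝ)) := Real.rpow_nonneg hℓ.le _
  have hℓN1 : 0 ≤ ℓ ^ (-((N + 1 : ℕ) : ℝ)) := Real.rpow_nonneg hℓ.le _
  have hmax0 : max B₀ 0 ≤ |Cin N| * (A * ℓ ^ (-(N : ℝ))) := by
    refine max_le ?_ (by positivity)
    exact mul_le_mul_of_nonneg_right (le_abs_self _) (mul_nonneg hA0 hℓN)
  have hmax1 : max B₁ 0 ≤ |Cin (N + 1)| * (A * ℓ ^ (-((N + 1 : ℕ) : ℝ))) := by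
    refine max_le ?_ (by positivity)
    exact mul_le_mul_of_nonneg_right (le_abs_self _) (mul_nonneg hA0 hℓN1)
  -- powers of `ℓ`
  have hℓα : ℓ ^ (-(N : ℝ)) ≤ ℓ ^ (-(N : ℝ) - α) :=
    Real.rpow_le_rpow_of_exponent_ge hℓ hℓ1 (by linarith)
  have hℓcomb : ℓ ^ (-((N + 1 : ℕ) : ℝ)) * ℓ ^ (1 - α) = ℓ ^ (-(N : ℝ) - α) := by
    rw [← Real.rpow_add hℓ]; congr 1; push_cast; ring
  have hℓinv : ℓ⁻¹ ^ α = ℓ ^ (-α) := by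
    rw [Real.inv_rpow hℓ.le, Real.rpow_neg hℓ.le]
  have hℓcomb' : ℓ ^ (-(N : ℝ)) * ℓ ^ (-α) = ℓ ^ (-(N : ℝ) - α) := by
    rw [← Real.rpow_add hℓ, sub_eq_add_neg]
  have hℓ1α : 0 ≤ ℓ ^ (1 - α) := Real.rpow_nonneg hℓ.le _
  have hℓα0 : 0 ≤ ℓ ^ (-α) := Real.rpow_nonneg hℓ.le _
  have hℓNα : 0 ≤ ℓ ^ (-(N : ℝ) - α) := Real.rpow_nonneg hℓ.le _
  rw [hℓinv]
  -- assemble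
  have e1 : ((N : ℝ) + 2) * max B₀ 0 ≤ ((N : ℝ) + 2) * |Cin N| * (A * ℓ ^ (-(N : ℝ) - α)) := by
    have : max B₀ 0 ≤ |Cin N| * (A * ℓ ^ (-(N : ℝ) - α)) :=
      hmax0.trans (mul_le_mul_of_nonneg_left (mul_le_mul_of_nonneg_left hℓα hA0) (abs_nonneg _))
    have hN2 : (0 : ℝ) ≤ (N : ℝ) + 2 := by positivity
    nlinarith
  have e2 : max B₁ 0 * ℓ ^ (1 - α) ≤ |Cin (N + 1)| * (A * ℓ ^ (-(N : ℝ) - α)) := by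
    calc max B₁ 0 * ℓ ^ (1 - α) ≤ |Cin (N + 1)| * (A * ℓ ^ (-((N + 1 : ℕ) : ℝ))) * ℓ ^ (1 - α) :=
          mul_le_mul_of_nonneg_right hmax1 hℓ1α
      _ = |Cin (N + 1)| * (A * (ℓ ^ (-((N + 1 : ℕ) : ℝ)) * ℓ ^ (1 - α))) := by ring
      _ = |Cin (N + 1)| * (A * ℓ ^ (-(N : ℝ) - α)) := by rw [hℓcomb]
  have e3 : 2 * max B₀ 0 * ℓ ^ (-α) ≤ 2 * |Cin N| * (A * ℓ ^ (-(N : ℝ) - α)) := by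
    calc 2 * max B₀ 0 * ℓ ^ (-α) ≤ 2 * (|Cin N| * (A * ℓ ^ (-(N : ℝ)))) * ℓ ^ (-α) := by
          gcongr
      _ = 2 * |Cin N| * (A * (ℓ ^ (-(N : ℝ)) * ℓ ^ (-α))) := by ring
      _ = 2 * |Cin N| * (A * ℓ ^ (-(N : ℝ) - α)) := by rw [hℓcomb']
  calc ((N : ℝ) + 2) * max B₀ 0 + (max B₁ 0 * ℓ ^ (1 - α) + 2 * max B₀ 0 * ℓ ^ (-α))
      ≤ ((N : ℝ) + 2) * |Cin N| * (A * ℓ ^ (-(N : ℝ) - α)) +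
          (|Cin (N + 1)| * (A * ℓ ^ (-(N : ℝ) - α)) + 2 * |Cin N| * (A * ℓ ^ (-(N : ℝ) - α))) :=
        add_le_add e1 (add_le_add e2 e3)
    _ = (((N : ℝ) + 4) * |Cin N| + |Cin (N + 1)|) * (A * ℓ ^ (-(N : ℝ) - α)) := by ring

end Interp

/-! ## Prop. 4.2 -/

section GluedVelocity

variable {β α a b T C₃ : ℝ} {q n Nb : ℕ} {vℓ : ℝ → 𝕋³ → ℝ³} {pℓ : ℝ → 𝕋³ → ℝ}
  {Rℓ : ℝ → 𝕋³ → Fin 3 → ℝ³} {v : ℕ → ℝ → 𝕋³ → ℝ³} {p : ℕ → ℝ → 𝕋³ → ℝ} {Cin : ℕ → ℝ}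

/-- **The convex decomposition of `v̄`**: at every `t ∈ [0,T]` there are `i, i' ≤ n` and
`θ ∈ [0,1]` with `t` in the life spans `Sᵢ`, `Sᵢ'` and `v̄(t) = θ vᵢ(t) + (1 - θ) vᵢ'(t)`
(`θ = χᵢ(t)`, `i' = i + 1` on `[tᵢ, tᵢ + τ]` for `i < n`; `v̄ = v_n` past `t_n`) (BDSV §4.1:
"`v̄_q = χᵢvᵢ + (1 - χᵢ)vᵢ₊₁`"). [cite: BuckmasterEtAl2018, §4.1] -/
theorem IsGlueFamily.exists_convex_decomp {τ : ℝ} (h : IsGlueFamily T τ n vℓ pℓ Rℓ v p) {t : ℝ}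
    (htT : t ∈ Icc 0 T) :
    ∃ i i' : ℕ, ∃ θ : ℝ, i ≤ n ∧ i' ≤ n ∧ θ ∈ Icc (0 : ℝ) 1 ∧
      t ∈ glueInterval T τ i ∧ t ∈ glueInterval T τ i' ∧
      ∀ x, gluedVel τ n v t x = θ • v i t x + (1 - θ) • v i' t x := by
  obtain ⟨i, hin, ht⟩ := h.exists_anchor htT
  rcases lt_or_eq_of_le hin with hi | rfl
  · exact ⟨i, i + 1, upperStep τ n i t, hin, Nat.succ_le_of_lt hi, upperStep_mem_Icc τ n i t,
      h.Icc_inter_subset_glueInterval i ⟨ht, htT⟩, h.Icc_inter_subset_glueInterval_succ i ⟨ht, htT⟩,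
      fun x => h.gluedVel_apply hin ht x⟩
  · refine ⟨i, i, 1, le_rfl, le_rfl, ⟨zero_le_one, le_rfl⟩, h.Icc_inter_subset_glueInterval i ⟨ht, htT⟩,
      h.Icc_inter_subset_glueInterval i ⟨ht, htT⟩, fun x => ?_⟩
    rw [h.gluedVel_apply_last ht x, one_smul, sub_self, zero_smul, add_zero]

/-- The exact solutions are smooth at the times of their life spans. [folklore] -/
theorem IsGlueFamily.isSmooth_v {τ : ℝ} (h : IsGlueFamily T τ n vℓ pℓ Rℓ v p) {i : ℕ} (hi : i ≤ n)
    {t : ℝ} (ht : t ∈ glueInterval T τ i) : FunctionSpaces.Torus.IsSmooth (v i t) :=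
  (h.exact i (h.anchor_le hi)).smooth_velocity.isSmooth_slice ht

/-- The mollified velocity is smooth at the times of `[0,T]`. [folklore] -/
theorem IsGlueFamily.isSmooth_vℓ {τ : ℝ} (h : IsGlueFamily T τ n vℓ pℓ Rℓ v p) {t : ℝ}
    (ht : t ∈ Icc 0 T) : FunctionSpaces.Torus.IsSmooth (vℓ t) :=
  h.er.smooth_velocity.isSmooth_slice ht

/-- **(3.12) transported to the glued velocity**: `‖v̄ - v_ℓ‖_{N+α} ≤ |C₃| τ_q δ_{q+1} ℓ^{-N-1+α}`
on `[0,T]` for `N ≤ N̄` (`v̄ - v_ℓ = θ(vᵢ - v_ℓ) + (1-θ)(vᵢ' - v_ℓ)` and Prop. 3.3 for both).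
[cite: BuckmasterEtAl2018, Prop. 4.2 (proof)] -/
theorem IsGlueFamily.holderSupLE_gluedVel_sub (h : IsGlueFamily T (glueScale β α a b q) n vℓ pℓ Rℓ v p)
    (hS : ∀ i : ℕ, i ≤ n → StabilityBounds β α a b T C₃ q Nb i vℓ pℓ (v i) (p i)) (ha : 1 ≤ a)
    {N : ℕ} (hN : N ≤ Nb) :
    HolderSupLE T (fun t x => gluedVel (glueScale β α a b q) n v t x - vℓ t x) N (Real.toNNReal α)
      (|C₃| * (glueScale β α a b q * amp β a b (q + 1) * mollScale β α a b q ^ (-(N : ℝ) - 1 + α))) := by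
  intro t htT
  obtain ⟨i, i', θ, hi, hi', hθ, hti, hti', hdec⟩ := h.exists_convex_decomp htT
  set τ := glueScale β α a b q with hτ
  set X := τ * amp β a b (q + 1) * mollScale β α a b q ^ (-(N : ℝ) - 1 + α) with hX
  have hX0 : 0 ≤ X := by
    have h1 := h.hτ
    have h2 := amp_pos (β := β) (b := b) ha (q + 1)
    have h3 := mollScale_pos (β := β) (α := α) (b := b) ha q
    positivity
  have hmono : ENNReal.ofReal (C₃ * X) ≤ ENNReal.ofReal (|C₃| * X) :=
    ENNReal.ofReal_le_ofReal (mul_le_mul_of_nonneg_right (le_abs_self _) hX0)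
  have hf := ((hS i hi).velocity_sub N hN t hti).trans hmono
  have hg := ((hS i' hi').velocity_sub N hN t hti').trans hmono
  have hvℓ := h.isSmooth_vℓ htT
  have hfs : IsContDiff N (fun x => v i t x - vℓ t x) :=
    ((h.isSmooth_v hi hti).sub hvℓ).isContDiff (mod_cast le_top)
  have hgs : IsContDiff N (fun x => v i' t x - vℓ t x) :=
    ((h.isSmooth_v hi' hti').sub hvℓ).isContDiff (mod_cast le_top)
  have hfun : (fun x => gluedVel τ n v t x - vℓ t x) =
      fun x => θ • (v i t x - vℓ t x) + (1 - θ) • (v i' t x - vℓ t x) := by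
    funext x
    rw [hdec x]
    simp only [smul_sub, sub_smul, one_smul]
    abel
  show FunctionSpaces.Torus.eContDiffHolderNorm N (Real.toNNReal α) (fun x => gluedVel τ n v t x - vℓ t x) ≤ _
  rw [hfun]
  exact eContDiffHolderNorm_convex_comb_le hfs hgs hθ hf hg

/-- **(2.18)** (= (4.4) of Prop. 4.2): `|v̄(t,x) - v_ℓ(t,x)| ≤ |C₃| δ_{q+1}^{1/2} ℓ^α` on
`[0,T] × T³` (from the `N = 0` case of `holderSupLE_gluedVel_sub` and (4.6)).
[cite: BuckmasterEtAl2018, Prop. 4.2 (4.4)] -/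
theorem IsGlueFamily.supLE_gluedVel_sub (h : IsGlueFamily T (glueScale β α a b q) n vℓ pℓ Rℓ v p)
    (hS : ∀ i : ℕ, i ≤ n → StabilityBounds β α a b T C₃ q Nb i vℓ pℓ (v i) (p i)) (ha : 1 ≤ a)
    (hb : 1 ≤ b) (hβ : 0 ≤ β) (hα : 0 ≤ α) :
    SupLE T (fun t x => gluedVel (glueScale β α a b q) n v t x - vℓ t x)
      (|C₃| * (Real.sqrt (amp β a b (q + 1)) * mollScale β α a b q ^ α)) := by
  intro t htT x
  have hH := h.holderSupLE_gluedVel_sub hS ha (Nat.zero_le Nb) t htT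
  have hpt := (Torus.enorm_le_eContDiffHolderNorm 0 (Real.toNNReal α)
    (fun y => gluedVel (glueScale β α a b q) n v t y - vℓ t y) x).trans hH
  have hB : 0 ≤ |C₃| * (Real.sqrt (amp β a b (q + 1)) * mollScale β α a b q ^ α) := by
    have := mollScale_pos (β := β) (α := α) (b := b) ha q
    positivity
  rw [← ofReal_norm] at hpt
  have hle : |C₃| * (glueScale β α a b q * amp β a b (q + 1) * mollScale β α a b q ^ (-((0 : ℕ) : ℝ) - 1 + α)) ≤
      |C₃| * (Real.sqrt (amp β a b (q + 1)) * mollScale β α a b q ^ α) := by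
    rw [Nat.cast_zero, neg_zero, zero_sub]
    exact mul_le_mul_of_nonneg_left (glueScale_mul_amp_succ_mul_rpow_le_sqrt ha hb hβ hα q) (abs_nonneg _)
  exact (ENNReal.ofReal_le_ofReal_iff hB).1 (hpt.trans (ENNReal.ofReal_le_ofReal hle))

/-- **(2.19)** (= (4.5) of Prop. 4.2): `‖v̄(t)‖_{N+1} ≤ (|Cin N| + 3|C₃|) δ_q^{1/2} λ_q ℓ^{-N}` on
`[0,T]` for `N + 1 ≤ N̄`, from (2.13) for `v_ℓ` and `‖v̄ - v_ℓ‖_{N+1} ≤ 3‖v̄ - v_ℓ‖_{N+1+α} ≤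
3|C₃|τ_qδ_{q+1}ℓ^{-N-2+α} ≤ 3|C₃|δ_q^{1/2}λ_qℓ^{-N}`. [cite: BuckmasterEtAl2018, Prop. 4.2 (4.5)] -/
theorem IsGlueFamily.holderSupLE_gluedVel (h : IsGlueFamily T (glueScale β α a b q) n vℓ pℓ Rℓ v p)
    (hS : ∀ i : ℕ, i ≤ n → StabilityBounds β α a b T C₃ q Nb i vℓ pℓ (v i) (p i)) (ha : 1 ≤ a)
    (hb : 1 ≤ b) (hβ : 0 ≤ β) (hα : 0 ≤ α)
    (h213 : ∀ N : ℕ, HolderSupLE T vℓ (N + 1) 0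
      (Cin N * (Real.sqrt (amp β a b q) * freq a b q * mollScale β α a b q ^ (-(N : ℝ)))))
    {N : ℕ} (hN : N + 1 ≤ Nb) :
    HolderSupLE T (gluedVel (glueScale β α a b q) n v) (N + 1) 0
      ((|Cin N| + 3 * |C₃|) * (Real.sqrt (amp β a b q) * freq a b q * mollScale β α a b q ^ (-(N : ℝ)))) := by
  intro t htT
  set τ := glueScale β α a b q with hτ
  set Y := Real.sqrt (amp β a b q) * freq a b q * mollScale β α a b q ^ (-(N : ℝ)) with hY
  have hY0 : 0 ≤ Y := by
    have h1 := amp_pos (β := β) (b := b) ha q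
    have h2 := freq_pos (b := b) ha q
    have h3 := mollScale_pos (β := β) (α := α) (b := b) ha q
    positivity
  have hvℓ : FunctionSpaces.Torus.eContDiffHolderNorm (N + 1) 0 (vℓ t) ≤ ENNReal.ofReal (|Cin N| * Y) :=
    (h213 N t htT).trans (ENNReal.ofReal_le_ofReal (mul_le_mul_of_nonneg_right (le_abs_self _) hY0))
  have hdiff := h.holderSupLE_gluedVel_sub hS ha hN t htT
  have hpar : τ * amp β a b (q + 1) * mollScale β α a b q ^ (-((N + 1 : ℕ) : ℝ) - 1 + α) ≤ Y := by
    have := glueScale_mul_amp_succ_mul_rpow_le ha hb hβ hα q (N : ℝ)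
    rwa [show (-((N + 1 : ℕ) : ℝ) - 1 + α) = -(N : ℝ) - 2 + α by push_cast; ring]
  have hdiff0 : FunctionSpaces.Torus.eContDiffHolderNorm (N + 1) 0 (fun x => gluedVel τ n v t x - vℓ t x) ≤
      ENNReal.ofReal (3 * |C₃| * Y) :=
    calc FunctionSpaces.Torus.eContDiffHolderNorm (N + 1) 0 (fun x => gluedVel τ n v t x - vℓ t x)
        ≤ 3 * FunctionSpaces.Torus.eContDiffHolderNorm (N + 1) (Real.toNNReal α) (fun x => gluedVel τ n v t x - vℓ t x) :=
          Torus.eContDiffHolderNorm_exponent_zero_le _ _ _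
      _ ≤ 3 * ENNReal.ofReal (|C₃| * (τ * amp β a b (q + 1) * mollScale β α a b q ^ (-((N + 1 : ℕ) : ℝ) - 1 + α))) := by
          gcongr
      _ ≤ 3 * ENNReal.ofReal (|C₃| * Y) := by gcongr
      _ = ENNReal.ofReal (3 * |C₃| * Y) := by
          rw [mul_assoc (3 : ℝ), ENNReal.ofReal_mul (by norm_num : (0 : ℝ) ≤ 3), ENNReal.ofReal_ofNat]
  have hvℓs : IsContDiff (N + 1 : ℕ) (vℓ t) := (h.isSmooth_vℓ htT).isContDiff (mod_cast le_top)
  have hds : IsContDiff (N + 1 : ℕ) (fun x => gluedVel τ n v t x - vℓ t x) :=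
    ((h.smooth_gluedVel.isSmooth_slice htT).sub (h.isSmooth_vℓ htT)).isContDiff (mod_cast le_top)
  have hfun : gluedVel τ n v t = vℓ t + fun x => gluedVel τ n v t x - vℓ t x := by
    funext x; simp
  rw [hfun]
  calc FunctionSpaces.Torus.eContDiffHolderNorm (N + 1) 0 (vℓ t + fun x => gluedVel τ n v t x - vℓ t x)
      ≤ FunctionSpaces.Torus.eContDiffHolderNorm (N + 1) 0 (vℓ t) +
          FunctionSpaces.Torus.eContDiffHolderNorm (N + 1) 0 (fun x => gluedVel τ n v t x - vℓ t x) :=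
        Torus.eContDiffHolderNorm_add_le hvℓs hds
    _ ≤ ENNReal.ofReal (|Cin N| * Y) + ENNReal.ofReal (3 * |C₃| * Y) := add_le_add hvℓ hdiff0
    _ = ENNReal.ofReal ((|Cin N| + 3 * |C₃|) * Y) := by
        rw [← ENNReal.ofReal_add (by positivity) (by positivity)]; ring_nf

end GluedVelocity

end BDSV

end Literature.Analysis.FluidPDE
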